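import Summits.QuantumFields.YangMills.Theorems.LangevinControlUVOSLegsAtWeakCouplingCSketchPencil2
import HarnessLib

/-!
# Crux `OSLegsAtWeakCouplingC` (stmt-QuantumFields-16207), line `Sketch`: the POINTWISE compositions (re-type kit)

Support file (continuation lead c5).  The landed compositions of line `Sketch`
(`conclC_of_outputs_germRot`, `osLegsAtWeakCouplingC_of_outputs_germWard`, `…_of_outputs_latticeWard` p136539;
`osLegsAtWeakCouplingC_of_outputs_pencil2` p137364) take the two hypothesis-side imports E0′ and NT as GLOBAL
implications `∀ G r a, (crux hypotheses) → MomentBounds6 G r a` / `… → LowerBounds G r a`.  A re-typed crux that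
carries E0′ and NT as additional hypotheses H4, H5 at the point `(G, r, a)` cannot feed those theorems.  This file
records the compositions in POINTWISE form, which is also their sharpest form — reading the landed proof shows that,
once `MomentBounds6 G r a` and `LowerBounds G r a` are in hand, the OS-legs glue uses of the crux hypotheses ONLY the
positivity `∀ β, 0 < a β` and the limit `a → 0` of the unit map (two clauses of H1) and H3 (`GapInUnits`): the
two-sided femto bounds of H1, the skewness witness H2, `Continuous a` and — for the Ward typings of E1 — even the
simplicity of `G` enter only through the imports.

* `conclC_of_legs_germRot` — for EVERY compact group `G`, every `r`, every positive unit map `a → 0`: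
  `GapInUnits ∧ MomentBounds6 ∧ LowerBounds` and det-1 planar germ invariance of every soft-bundle limit that is
  `RPPos`, density-bounded and signed-permutation invariant ⟹ `ConclC G r a`;
* `conclC_of_legs_germWard` — the same with the rotation WARD IDENTITY on the germ of the bundle limit (E1, limit form);
* `conclC_of_legs_latticeWard` — the same with the LATTICE rotation-Ward defect `→ 0` along schemes in units `a`
  (E1, lattice form: a statement about lattice Yang–Mills alone);
* `conclC_of_legs_pencil` — for compact SIMPLE `G`: `GapInUnits ∧ MomentBounds6 ∧ LowerBounds` and the two items
  `PencilRigidity.DiagonalMirrorRPR` (stmt-QuantumFields-10604), `PencilRigidity.NPointIsotropy` (stmt-QuantumFields-11686)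
  ⟹ `ConclC G r a` (E1 cross-route, `CurvatureKernelBound` discharged along the bundle by E0′);
* `osLegsAtWeakCouplingC_retyped_latticeWard`, `osLegsAtWeakCouplingC_retyped_pencil` — the two candidate RE-TYPED
  crux statements (H1, H2, H3, `Continuous a` kept verbatim; H4 := `MomentBounds6 G r a`, H5 := `LowerBounds G r a`,
  H6 := the E1 input, added pointwise), PROVED: a planner who files either closes it by `exact`;
* `osLegsAtWeakCouplingC_of_pointwise_legs`, `…_pencil`, `…_ward` — the crux BY NAME from the pointwise legs
  (conditional results; the three E1 typings).

Tree vocabulary only; no definitions.  Refs: OsterwalderSchrader1973 §4; OsterwalderSchrader1975 §2; GlimmJaffe1987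
§6.1/§19; JaffeWitten2000 §4/§6; Balaban1989LargeFieldII and MagnenRivasseauSeneor1993 (E0′/NT as engine outputs).
-/

set_option autoImplicit false

noncomputable section

open scoped SchwartzMap ComplexConjugate BigOperators
open MeasureTheory Filter Topology
open Literature.MathematicalPhysics.QuantumFieldTheory Literature.MathematicalPhysics.QuantumLattice
open Literature.MathematicalPhysics.AQFT Literature.Probability.LatticeModels
open Summit.QuantumFields.YangMills.Theses.LangevinControlUV (OSLegsAtWeakCouplingC)
open Summit.QuantumFields.YangMills.Theses.PencilRigidity (DiagonalMirrorRPR NPointIsotropy)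
open Summit.QuantumFields.YangMills.Cruxes.OSLegsFromFemtoAndGap.DlrCollarTransfer
open Summit.QuantumFields.YangMills.Theorems.OSLegsFromFemtoAndGap (isHermitian_of_isReflectionPositive latticeDist)
open Summit.QuantumFields.YangMills.Theorems.HypercubicLimit.Negative (onlySpecies extendByZero)
open Summit.QuantumFields.YangMills.Theorems.NPointIsotropy.Negative (E4)
open Summit.QuantumFields.YangMills.Theorems.NPointIsotropy.ComplexRotationBandlimit.Mopup (exists_eq_planeRot)
open Summit.QuantumFields.YangMills.Theorems.KernelTransfer (kernelTransfer_proof)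
open Summit.QuantumFields.YangMills.Cruxes.ShellRigidity.TransverseSmearingPlanarThreshold (ShellRigidity_proof)
open Summit.QuantumFields.YangMills.Theorems.CurvatureChannel (isReflectionPositive_comp_axisFrame)
open Summit.QuantumFields.YangMills.Theorems.CurvatureKernel (KernelConclusionOfWitnessLocalDecay)

namespace Summit.QuantumFields.YangMills.Cruxes.OSLegsAtWeakCouplingC.Sketch

/-! ## §1 Pointwise compositions with a germ-level E1 input (any compact `G`) -/

section Germ

variable {G : Type} [Group G] [TopologicalSpace G] [IsTopologicalGroup G] [CompactSpace G]
  [MeasurableSpace G] [BorelSpace G]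

/-- **OS legs, pointwise, from the det-1 planar germ.**  For every compact group `G`, every lattice representation
`r` and every positive unit map `a → 0`: H3 (`GapInUnits`), E0′ (`MomentBounds6`), NT (`LowerBounds`) and det-1 planar
germ invariance of every soft-bundle limit in units `a` that is `RPPos`, density-bounded off the diagonal and
signed-permutation invariant give `ConclC G r a` (the landed `conclC_of_outputs_germRot`, pointwise: rope demands,
soft bundle, `RPPos ∧ Decay`, signed permutations, densities, germ ⇒ planar invariance by `stub_locality`, `SO(4)` by
Givens generation, E2/E4/hermiticity/gap, one field extended by zero). -/
theorem conclC_of_legs_germRot (r : LatticeRep G) (a : ℝ → ℝ) (hapos : ∀ β, 0 < a β)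
    (ha0 : Tendsto a atTop (𝓝 0)) (h3 : GapInUnits G r a) (h4 : MomentBounds6 G r a) (h5 : LowerBounds G r a)
    (hgerm : ∀ (sch : SpeciesScheme (YMSpecies G)) (S₁ : SchwingerFamily E4)
      (Tq : (n : ℕ) → (Fin n → Fin 4 × Fin 4) → (𝓢((Fin n → E4), ℂ) →L[ℂ] ℂ)) (K : ℝ) (b₀ : ℝ) (g : ℝ → ℕ → ℕ),
      SoftBundle G r a sch S₁ Tq K b₀ g → RPPos S₁ → OffDiagDensity S₁ →
      (∀ R : E4 ≃ₗᵢ[ℝ] E4, IsSignedPerm R → Invariant S₁ R) →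
        ∃ r₀ : ℝ, 0 < r₀ ∧ ∀ R : E4 ≃ₗᵢ[ℝ] E4, LinearMap.det (R.toLinearEquiv : E4 →ₗ[ℝ] E4) = 1 →
          IsPlanar01 R → GermInvariant S₁ R r₀) :
    ConclC G r a := by
  -- the rope's demands, then the soft bundle meeting them
  obtain ⟨b₀, g, Δ, hΔ, hRD⟩ := stub_rope G r a hapos ha0 h3
  obtain ⟨sch, S₁, Tq, K, hB⟩ := stub_growth G r a hapos ha0 h4 h5 h3 b₀ g
  obtain ⟨hRP, hDec⟩ := hRD sch S₁ Tq K hB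
  have hsigned : ∀ R : E4 ≃ₗᵢ[ℝ] E4, IsSignedPerm R → Invariant S₁ R :=
    fun R hR n F hF => stub_hypercubic G r a sch S₁ Tq K b₀ g hB n R hR F hF
  have hdens : OffDiagDensity S₁ := stub_density G r a sch S₁ Tq K b₀ g h4 hB
  -- the germ input, fed with everything the line has proved about `S₁`
  obtain ⟨r₀, hr₀, hgermR⟩ := hgerm sch S₁ Tq K b₀ g hB hRP hdens hsigned
  -- unpack the bundle
  obtain ⟨⟨hunits, -, -, hβ, hN, hLG, hE3, htrans, h0, h1', -, -, hYM, hnt, hng, ⟨Δ', hΔ', hlat⟩, -⟩, -⟩ := hB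
  -- continuum side
  obtain ⟨hCS, hgapOf⟩ := stub_gap S₁ h0 htrans hRP
  have hE4 : S₁.toLabelled.HasClusterProperty :=
    stub_cluster S₁ Δ hΔ h0 h1' htrans (fun n R hR F hF => hsigned R hR n F hF) hCS hDec
  have hplanar : ∀ R : E4 ≃ₗᵢ[ℝ] E4, LinearMap.det (R.toLinearEquiv : E4 →ₗ[ℝ] E4) = 1 → IsPlanar01 R →
      Invariant S₁ R := fun R hdet hR =>
    stub_locality S₁ h0 htrans hE3 hLG hRP hsigned hdens R hR r₀ hr₀ (hgermR R hdet hR)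
  have hE1 : S₁.toLabelled.IsEuclideanInvariant := isEuclideanInvariant_of_planarRot S₁ htrans hsigned hplanar
  have hE2 : S₁.toLabelled.IsReflectionPositive := isReflectionPositive_of_rpPos hRP
  have hherm : S₁.toLabelled.IsHermitian := isHermitian_of_isReflectionPositive S₁ hN hE2
  have hOS : OSAxiomsSchwinger S₁.toLabelled :=
    { normalized := hN, hermitian := hherm, invariant := hE1, reflectionPositive := hE2, symmetric := hE3,
      cluster := hE4, linearGrowth := hLG }
  -- one field extended by zero to all species
  have hnt' : ∃ (F₁ G₁ : 𝓢((Fin 1 → E4), ℂ)) (H₁ : 𝓢((Fin (1 + 1) → E4), ℂ)),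
      IsTimeOrdered F₁ ∧ IsTimeOrdered G₁ ∧ IsAppendTensorOf H₁ (osAdjoint F₁) G₁ ∧
        S₁ (1 + 1) H₁ ≠ S₁ 1 (osAdjoint F₁) * S₁ 1 G₁ := by
    simpa using hnt
  have hng' : ∃ (f g h : 𝓢(E4, ℂ)) (Ffgh : 𝓢((Fin 3 → E4), ℂ)) (Fgh Ffh Ffg : 𝓢((Fin 2 → E4), ℂ))
      (Ff Fg Fh : 𝓢((Fin 1 → E4), ℂ)),
      IsTensorOf Ffgh ![f, g, h] ∧ IsOffDiagonal Ffgh ∧ IsTensorOf Fgh ![g, h] ∧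
      IsTensorOf Ffh ![f, h] ∧ IsTensorOf Ffg ![f, g] ∧ IsTensorOf Ff ![f] ∧ IsTensorOf Fg ![g] ∧
      IsTensorOf Fh ![h] ∧
        S₁ 3 Ffgh - S₁ 1 Ff * S₁ 2 Fgh - S₁ 1 Fg * S₁ 2 Ffh - S₁ 1 Fh * S₁ 2 Ffg +
          2 * (S₁ 1 Ff * S₁ 1 Fg * S₁ 1 Fh) ≠ 0 := by
    simpa using hng
  obtain ⟨T, hYM', hntT, hngT⟩ := exists_osData_of_oneField r sch S₁ hOS hYM hnt' hng'
  exact ⟨onlySpecies sch r.curvature, T, hunits, hβ, hYM', hntT, hngT, Δ', hΔ', hlat⟩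

/-- **OS legs, pointwise, from the rotation Ward identity on the germ** (E1 in limit form).  For every compact
group `G`, every `r` and every positive unit map `a → 0`: H3, E0′, NT and — for every soft-bundle limit `S₁` in units
`a` that is `RPPos`, density-bounded and signed-permutation invariant — the Ward identity `S₁ n D = 0` for the
generator derivative `D` of every compactly supported, separated, off-diagonal `F` of small diameter (`n ≥ 2`) give
`ConclC G r a` (every det-1 planar isometry is a `planeRot 0 φ`; the density bound integrates the identity along the
orbit, `GermWard.germInvariant_planeRot_of_ward`). -/
theorem conclC_of_legs_germWard (r : LatticeRep G) (a : ℝ → ℝ) (hapos : ∀ β, 0 < a β)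
    (ha0 : Tendsto a atTop (𝓝 0)) (h3 : GapInUnits G r a) (h4 : MomentBounds6 G r a) (h5 : LowerBounds G r a)
    (hward : ∀ (sch : SpeciesScheme (YMSpecies G)) (S₁ : SchwingerFamily E4)
      (Tq : (n : ℕ) → (Fin n → Fin 4 × Fin 4) → (𝓢((Fin n → E4), ℂ) →L[ℂ] ℂ)) (K : ℝ) (b₀ : ℝ) (g : ℝ → ℕ → ℕ),
      SoftBundle G r a sch S₁ Tq K b₀ g → RPPos S₁ → OffDiagDensity S₁ →
      (∀ R : E4 ≃ₗᵢ[ℝ] E4, IsSignedPerm R → Invariant S₁ R) →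
        ∃ r₀ : ℝ, 0 < r₀ ∧ ∀ (n : ℕ), 2 ≤ n → ∀ (F D : 𝓢((Fin n → E4), ℂ)), IsOffDiagonal F →
          HasCompactSupport (F : (Fin n → E4) → ℂ) →
          (∃ δ : ℝ, 0 < δ ∧ tsupport (F : (Fin n → E4) → ℂ) ⊆ Separated n δ) →
          tsupport (F : (Fin n → E4) → ℂ) ⊆ SmallDiam n r₀ →
          (∀ x, D x = fderiv ℝ (F : (Fin n → E4) → ℂ) x
            (fun k => (x k 0) • (EuclideanSpace.single 1 1 : E4) - (x k 1) • (EuclideanSpace.single 0 1 : E4))) →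
          S₁ n D = 0) :
    ConclC G r a := by
  refine conclC_of_legs_germRot r a hapos ha0 h3 h4 h5 fun sch S₁ Tq K b₀ g hB hRP hdens hsigned => ?_
  obtain ⟨r₀, hr₀, hW⟩ := hward sch S₁ Tq K b₀ g hB hRP hdens hsigned
  -- the bundle's one-point clause `S₁ 1 = 0`
  obtain ⟨⟨-, -, -, -, -, -, -, -, -, hS1, -⟩, -⟩ := hB
  refine ⟨r₀, hr₀, fun R hdet hR => ?_⟩
  obtain ⟨φ, rfl⟩ := exists_eq_planeRot R hdet hR.1 hR.2
  exact GermWard.germInvariant_planeRot_of_ward S₁ hdens hS1 hW φ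

/-- **OS legs, pointwise, from the LATTICE rotation-Ward defect** (E1 in lattice form).  For every compact group
`G`, every `r` and every positive unit map `a → 0`: H3, E0′, NT, and — along every scheme in units `a` with
`β_k → ∞` and the bundle's torus ranges — the existence of `r₀ > 0` such that for `n ≥ 2` the centred,
`a⁻⁴`-renormalised lattice `n`-point distributions of the action density annihilate, as `k → ∞`, the generator
derivative of every compactly supported, separated, off-diagonal test function of diameter `< r₀`, give `ConclC G r a`
(`germRotAt_of_latticeWardAt`: bundle convergence + uniqueness of limits ⇒ the Ward identity on the germ). -/
theorem conclC_of_legs_latticeWard (r : LatticeRep G) (a : ℝ → ℝ) (hapos : ∀ β, 0 < a β)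
    (ha0 : Tendsto a atTop (𝓝 0)) (h3 : GapInUnits G r a) (h4 : MomentBounds6 G r a) (h5 : LowerBounds G r a)
    (hlat : ∀ (sch : SpeciesScheme (YMSpecies G)), (∀ k, sch.a k = a (sch.β k)) → Tendsto sch.β atTop atTop →
      (∀ k, 0 ≤ sch.β k ∧ sch.a k ≤ 1 / 24 ∧ 14 ≤ sch.L k ∧ (sch.a k)⁻¹ * (sch.a k)⁻¹ ≤ sch.L k) →
        ∃ r₀ : ℝ, 0 < r₀ ∧ ∀ (n : ℕ), 2 ≤ n → ∀ (F D : 𝓢((Fin n → E4), ℂ)), IsOffDiagonal F →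
          HasCompactSupport (F : (Fin n → E4) → ℂ) →
          (∃ δ : ℝ, 0 < δ ∧ tsupport (F : (Fin n → E4) → ℂ) ⊆ Separated n δ) →
          tsupport (F : (Fin n → E4) → ℂ) ⊆ SmallDiam n r₀ →
          (∀ x, D x = fderiv ℝ (F : (Fin n → E4) → ℂ) x
            (fun k => (x k 0) • (EuclideanSpace.single 1 1 : E4) - (x k 1) • (EuclideanSpace.single 0 1 : E4))) →
          Tendsto (fun k => latticeDist r.ρ (sch.β k) (sch.L k) (sch.a k) r.curvature.F
            (wilsonTorusMean r.ρ (sch.β k) (sch.L k) r.curvature.F) n D) atTop (𝓝 0)) :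
    ConclC G r a := by
  refine conclC_of_legs_germRot r a hapos ha0 h3 h4 h5 fun sch S₁ Tq K b₀ g hB _ hdens _ => ?_
  -- the scheme clauses the lattice statement asks for are bundle clauses
  obtain ⟨⟨hunits, -, -, hβ, -, -, -, -, -, -, -, -, -, -, -, -, hranges, -⟩, -⟩ := id hB
  obtain ⟨r₀, hr₀, hW⟩ := hlat sch hunits hβ hranges
  exact germRotAt_of_latticeWardAt r a sch S₁ Tq K b₀ g hB hdens hr₀ hW

end Germ

/-! ## §2 Pointwise composition with the two `PencilRigidity` items (compact simple `G`, Borel σ-algebra) -/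

section Pencil

variable {G : Type} [Group G] [TopologicalSpace G] [IsTopologicalGroup G] [CompactSpace G]

/-- **OS legs, pointwise, from two items of route `PencilRigidity`.**  For every compact SIMPLE `G`, every `r` and
every positive unit map `a → 0`: H3, E0′, NT and the items `DiagonalMirrorRPR` (stmt-QuantumFields-10604) and
`NPointIsotropy` (stmt-QuantumFields-11686) give `ConclC G r a` (the landed `osLegsAtWeakCouplingC_of_outputs_pencil2`,
pointwise: the soft-bundle limit carries the one-species package `W₁` at gap rate `min Δ Δ'`; axis frames by signed
permutations, diagonal frames by the first item; the two-point kernel from E0′ via `twoPointLocalDecay_of_bundle` and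
`KernelConclusionOfWitnessLocalDecay`; `KernelTransfer` + `ShellRigidity` make it radial; the second item gives planar
det-1 invariance; Givens generation gives `SO(4)`). -/
theorem conclC_of_legs_pencil (hG : IsCompactSimpleLieGroup G) :
    letI : MeasurableSpace G := borel G; haveI : BorelSpace G := ⟨rfl⟩;
    ∀ (r : LatticeRep G) (a : ℝ → ℝ), (∀ β, 0 < a β) → Tendsto a atTop (𝓝 0) → GapInUnits G r a →
      MomentBounds6 G r a → LowerBounds G r a → DiagonalMirrorRPR → NPointIsotropy → ConclC G r a := by
  letI : MeasurableSpace G := borel G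
  haveI : BorelSpace G := ⟨rfl⟩
  intro r a hapos ha0 h3 h4 h5 hDiag hNP
  -- the rope's demands, then the soft bundle meeting them
  obtain ⟨b₀, g, Δ, hΔ, hRD⟩ := stub_rope G r a hapos ha0 h3
  obtain ⟨sch, S₁, Tq, K, hB⟩ := stub_growth G r a hapos ha0 h4 h5 h3 b₀ g
  obtain ⟨hRP, hDec⟩ := hRD sch S₁ Tq K hB
  have hsigned : ∀ R : E4 ≃ₗᵢ[ℝ] E4, IsSignedPerm R → Invariant S₁ R :=
    fun R hR n F hF => stub_hypercubic G r a sch S₁ Tq K b₀ g hB n R hR F hF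
  -- the two-point local decay of the limit, from E0′ (before the bundle is unpacked)
  have hDecay := twoPointLocalDecay_of_bundle r a sch S₁ Tq K b₀ g h4 hB
  -- unpack the bundle
  obtain ⟨⟨hunits, -, -, hβ, hN, hLG, hE3, htrans, h0, h1', -, -, hYM, hnt, hng, ⟨Δ', hΔ', hlat⟩, -⟩, -⟩ := hB
  -- continuum side, everything but rotations
  obtain ⟨hCS, hgapOf⟩ := stub_gap S₁ h0 htrans hRP
  have hE4 : S₁.toLabelled.HasClusterProperty :=
    stub_cluster S₁ Δ hΔ h0 h1' htrans (fun n R hR F hF => hsigned R hR n F hF) hCS hDec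
  have hE2 : S₁.toLabelled.IsReflectionPositive := isReflectionPositive_of_rpPos hRP
  have hherm : S₁.toLabelled.IsHermitian := isHermitian_of_isReflectionPositive S₁ hN hE2
  have hgap : S₁.toLabelled.HasMassGap Δ := hgapOf Δ hΔ hDec
  have hhypDet : ∀ R : E4 ≃ₗᵢ[ℝ] E4, LinearMap.det (R.toLinearEquiv : E4 →ₗ[ℝ] E4) = 1 →
      (∀ i : Fin 4, ∃ j : Fin 4, R (EuclideanSpace.single i 1) = EuclideanSpace.single j 1 ∨
        R (EuclideanSpace.single i 1) = -EuclideanSpace.single j 1) →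
      ∀ (n : ℕ) (F : 𝓢((Fin n → E4), ℂ)), IsOffDiagonal F → S₁ n (linActMulti R F) = S₁ n F :=
    fun R _ hR n F hF => hsigned R hR n F hF
  -- the one-species package `W₁` of route `PencilRigidity`, at the common gap rate `min Δ Δ'`
  have hΔ₀ : 0 < min Δ Δ' := lt_min hΔ hΔ'
  have hgap₀ : S₁.toLabelled.HasMassGap (min Δ Δ') := hasMassGap_anti hgap (min_le_left _ _)
  have hlat₀ : HasLatticeMassGap r sch (min Δ Δ') := hasLatticeMassGap_anti r sch hlat (min_le_right _ _)
  -- reflection positivity in the eight planar frames: axis frames by signed permutations, diagonal frames by the item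
  have h8 : ∀ (R : E4 ≃ₗᵢ[ℝ] E4) (p q : ℝ), p ^ 2 + q ^ 2 = 1 → (p = 0 ∨ q = 0 ∨ p ^ 2 = q ^ 2) →
      R (EuclideanSpace.single 0 1) = p • EuclideanSpace.single 0 1 + q • EuclideanSpace.single 1 1 →
      (SchwingerFamily.toLabelled (fun n => (S₁ n).comp (linActMulti R))).IsReflectionPositive := by
    intro R p q hpq hcase hR
    rcases hcase with hc | hc | hc
    · exact isReflectionPositive_comp_axisFrame S₁ hE2 hhypDet R p q hpq (Or.inl hc) hR
    · exact isReflectionPositive_comp_axisFrame S₁ hE2 hhypDet R p q hpq (Or.inr hc) hR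
    · have hp : p ^ 2 = 1 / 2 := by linarith
      have hq : q ^ 2 = 1 / 2 := by linarith
      exact hDiag G hG r sch S₁ ⟨hYM, ⟨hN, hherm, hLG, hE2, hE3, hE4⟩, htrans, hhypDet, min Δ Δ', hΔ₀, hgap₀, hlat₀⟩
        R p q hp hq hR
  -- UV input, DISCHARGED: the two-point local decay of the bundle limit (E0′) fed to the landed per-witness theorem
  obtain ⟨Kk, C, η, hη, hcont, hbd, hrep⟩ :=
    KernelConclusionOfWitnessLocalDecay G hG r sch S₁
      ⟨hYM, ⟨hN, hherm, hLG, hE2, hE3, hE4⟩, htrans, hhypDet, min Δ Δ', hΔ₀, hgap₀, hlat₀⟩ hDecay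
  -- distribution-level symmetries and the eight frames, moved to the kernel (landed `KernelTransfer`)
  obtain ⟨hB4, hpos0, hposD⟩ := kernelTransfer_proof S₁ Kk hcont hrep hE3 hhypDet h8
  -- mass-shell pencil rigidity (landed `ShellRigidity`): the kernel is O(4)-invariant off the origin
  have hiso := ShellRigidity_proof Kk hcont ⟨C, η, hη, hbd⟩ hB4 hpos0 hposD
  -- n-point upgrade (the item): planar det-1 invariance on `⁰𝒮`
  have hplanarAll := hNP G hG r sch S₁
    ⟨hYM, ⟨hN, hherm, hLG, hE2, hE3, hE4⟩, htrans, hhypDet, min Δ Δ', hΔ₀, hgap₀, hlat₀⟩ h8 ⟨Kk, hcont, hiso, hrep⟩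
  have hplanar : ∀ R : E4 ≃ₗᵢ[ℝ] E4, LinearMap.det (R.toLinearEquiv : E4 →ₗ[ℝ] E4) = 1 → IsPlanar01 R →
      Invariant S₁ R := fun R hdet hR n F hF => hplanarAll R hdet hR.1 hR.2 n F hF
  -- E1 by Givens generation, then the OS axioms of `S₁`
  have hE1 : S₁.toLabelled.IsEuclideanInvariant := isEuclideanInvariant_of_planarRot S₁ htrans hsigned hplanar
  have hOS : OSAxiomsSchwinger S₁.toLabelled :=
    { normalized := hN, hermitian := hherm, invariant := hE1, reflectionPositive := hE2, symmetric := hE3,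
      cluster := hE4, linearGrowth := hLG }
  -- one field extended by zero to all species
  have hnt' : ∃ (F₁ G₁ : 𝓢((Fin 1 → E4), ℂ)) (H₁ : 𝓢((Fin (1 + 1) → E4), ℂ)),
      IsTimeOrdered F₁ ∧ IsTimeOrdered G₁ ∧ IsAppendTensorOf H₁ (osAdjoint F₁) G₁ ∧
        S₁ (1 + 1) H₁ ≠ S₁ 1 (osAdjoint F₁) * S₁ 1 G₁ := by
    simpa using hnt
  have hng' : ∃ (f g h : 𝓢(E4, ℂ)) (Ffgh : 𝓢((Fin 3 → E4), ℂ)) (Fgh Ffh Ffg : 𝓢((Fin 2 → E4), ℂ))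
      (Ff Fg Fh : 𝓢((Fin 1 → E4), ℂ)),
      IsTensorOf Ffgh ![f, g, h] ∧ IsOffDiagonal Ffgh ∧ IsTensorOf Fgh ![g, h] ∧
      IsTensorOf Ffh ![f, h] ∧ IsTensorOf Ffg ![f, g] ∧ IsTensorOf Ff ![f] ∧ IsTensorOf Fg ![g] ∧
      IsTensorOf Fh ![h] ∧
        S₁ 3 Ffgh - S₁ 1 Ff * S₁ 2 Fgh - S₁ 1 Fg * S₁ 2 Ffh - S₁ 1 Fh * S₁ 2 Ffg +
          2 * (S₁ 1 Ff * S₁ 1 Fg * S₁ 1 Fh) ≠ 0 := by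
    simpa using hng
  obtain ⟨T, hYM', hntT, hngT⟩ := exists_osData_of_oneField r sch S₁ hOS hYM hnt' hng'
  exact ⟨onlySpecies sch r.curvature, T, hunits, hβ, hYM', hntT, hngT, Δ', hΔ', hlat⟩

end Pencil

/-! ## §3 The two candidate re-typed crux statements, proved -/

/-- **Re-typed crux, lattice-Ward form (candidate C″; PROVED).**  `OSLegsAtWeakCouplingC` with three hypotheses added
pointwise after H1–H3 — H4 := `MomentBounds6 G r a` (E0′), H5 := `LowerBounds G r a` (NT), H6 := the lattice
rotation-Ward defect `→ 0` along schemes in units `a` with `β_k → ∞` and the bundle ranges (E1, lattice form) — holds: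
`conclC_of_legs_latticeWard` (H1 is used only through `a > 0`, `a → 0`; H2 and `Continuous a` not at all). -/
theorem osLegsAtWeakCouplingC_retyped_latticeWard :
    ∀ (G : Type) [Group G] [TopologicalSpace G] [IsTopologicalGroup G] [CompactSpace G],
      IsCompactSimpleLieGroup G → letI : MeasurableSpace G := borel G; haveI : BorelSpace G := ⟨rfl⟩;
      ∀ (r : LatticeRep G) (a : ℝ → ℝ), Continuous a → TwoPoint G r a → Skewness G r a → GapInUnits G r a →
        MomentBounds6 G r a → LowerBounds G r a →
        (∀ (sch : SpeciesScheme (YMSpecies G)), (∀ k, sch.a k = a (sch.β k)) → Tendsto sch.β atTop atTop →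
          (∀ k, 0 ≤ sch.β k ∧ sch.a k ≤ 1 / 24 ∧ 14 ≤ sch.L k ∧ (sch.a k)⁻¹ * (sch.a k)⁻¹ ≤ sch.L k) →
            ∃ r₀ : ℝ, 0 < r₀ ∧ ∀ (n : ℕ), 2 ≤ n → ∀ (F D : 𝓢((Fin n → E4), ℂ)), IsOffDiagonal F →
              HasCompactSupport (F : (Fin n → E4) → ℂ) →
              (∃ δ : ℝ, 0 < δ ∧ tsupport (F : (Fin n → E4) → ℂ) ⊆ Separated n δ) →
              tsupport (F : (Fin n → E4) → ℂ) ⊆ SmallDiam n r₀ →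
              (∀ x, D x = fderiv ℝ (F : (Fin n → E4) → ℂ) x
                (fun k => (x k 0) • (EuclideanSpace.single 1 1 : E4) - (x k 1) • (EuclideanSpace.single 0 1 : E4))) →
              Tendsto (fun k => latticeDist r.ρ (sch.β k) (sch.L k) (sch.a k) r.curvature.F
                (wilsonTorusMean r.ρ (sch.β k) (sch.L k) r.curvature.F) n D) atTop (𝓝 0)) →
        ConclC G r a := by
  intro G _ _ _ _ _
  letI : MeasurableSpace G := borel G
  haveI : BorelSpace G := ⟨rfl⟩
  intro r a _ h1 _ h3 h4 h5 h6
  obtain ⟨-, -, -, -, -, -, -, hapos, ha0, -, -⟩ := id h1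
  exact conclC_of_legs_latticeWard r a hapos ha0 h3 h4 h5 h6

/-- **Re-typed crux, pencil form (candidate C‴; PROVED).**  `OSLegsAtWeakCouplingC` with H4 := `MomentBounds6 G r a`
and H5 := `LowerBounds G r a` added pointwise after H1–H3, and the two `PencilRigidity` items `DiagonalMirrorRPR`
(stmt-QuantumFields-10604) and `NPointIsotropy` (stmt-QuantumFields-11686) as global hypotheses, holds:
`conclC_of_legs_pencil`. -/
theorem osLegsAtWeakCouplingC_retyped_pencil (hDiag : DiagonalMirrorRPR) (hNP : NPointIsotropy) :
    ∀ (G : Type) [Group G] [TopologicalSpace G] [IsTopologicalGroup G] [CompactSpace G],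
      IsCompactSimpleLieGroup G → letI : MeasurableSpace G := borel G; haveI : BorelSpace G := ⟨rfl⟩;
      ∀ (r : LatticeRep G) (a : ℝ → ℝ), Continuous a → TwoPoint G r a → Skewness G r a → GapInUnits G r a →
        MomentBounds6 G r a → LowerBounds G r a → ConclC G r a := by
  intro G _ _ _ _ hG
  letI : MeasurableSpace G := borel G
  haveI : BorelSpace G := ⟨rfl⟩
  intro r a _ h1 _ h3 h4 h5
  obtain ⟨-, -, -, -, -, -, -, hapos, ha0, -, -⟩ := id h1
  exact conclC_of_legs_pencil hG r a hapos ha0 h3 h4 h5 hDiag hNP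

/-- **The crux BY NAME from the pointwise legs** (conditional result): if E0′, NT and the lattice Ward leg hold
at every `(G, r, a)` carrying the crux hypotheses, `OSLegsAtWeakCouplingC` follows (`cruxC_iff` +
`osLegsAtWeakCouplingC_retyped_latticeWard`). -/
theorem osLegsAtWeakCouplingC_of_pointwise_legs
    (hlegs : ∀ (G : Type) [Group G] [TopologicalSpace G] [IsTopologicalGroup G] [CompactSpace G]
      [MeasurableSpace G] [BorelSpace G], IsCompactSimpleLieGroup G →
      ∀ (r : LatticeRep G) (a : ℝ → ℝ), Continuous a → TwoPoint G r a → Skewness G r a → GapInUnits G r a →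
        MomentBounds6 G r a ∧ LowerBounds G r a ∧
        ∀ (sch : SpeciesScheme (YMSpecies G)), (∀ k, sch.a k = a (sch.β k)) → Tendsto sch.β atTop atTop →
          (∀ k, 0 ≤ sch.β k ∧ sch.a k ≤ 1 / 24 ∧ 14 ≤ sch.L k ∧ (sch.a k)⁻¹ * (sch.a k)⁻¹ ≤ sch.L k) →
            ∃ r₀ : ℝ, 0 < r₀ ∧ ∀ (n : ℕ), 2 ≤ n → ∀ (F D : 𝓢((Fin n → E4), ℂ)), IsOffDiagonal F →
              HasCompactSupport (F : (Fin n → E4) → ℂ) →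
              (∃ δ : ℝ, 0 < δ ∧ tsupport (F : (Fin n → E4) → ℂ) ⊆ Separated n δ) →
              tsupport (F : (Fin n → E4) → ℂ) ⊆ SmallDiam n r₀ →
              (∀ x, D x = fderiv ℝ (F : (Fin n → E4) → ℂ) x
                (fun k => (x k 0) • (EuclideanSpace.single 1 1 : E4) - (x k 1) • (EuclideanSpace.single 0 1 : E4))) →
              Tendsto (fun k => latticeDist r.ρ (sch.β k) (sch.L k) (sch.a k) r.curvature.F
                (wilsonTorusMean r.ρ (sch.β k) (sch.L k) r.curvature.F) n D) atTop (𝓝 0)) :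
    OSLegsAtWeakCouplingC := by
  rw [cruxC_iff]
  intro G _ _ _ _ hG
  letI : MeasurableSpace G := borel G
  haveI : BorelSpace G := ⟨rfl⟩
  intro r a ha h1 h2 h3
  obtain ⟨h4, h5, h6⟩ := hlegs G hG r a ha h1 h2 h3
  exact osLegsAtWeakCouplingC_retyped_latticeWard G hG r a ha h1 h2 h3 h4 h5 h6

/-- **The crux BY NAME from the pointwise legs, pencil form** (conditional result): E0′ and NT at every `(G, r, a)`
carrying the crux hypotheses, plus the two `PencilRigidity` items, give `OSLegsAtWeakCouplingC`
(`cruxC_iff` + `osLegsAtWeakCouplingC_retyped_pencil`). -/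
theorem osLegsAtWeakCouplingC_of_pointwise_legs_pencil (hDiag : DiagonalMirrorRPR) (hNP : NPointIsotropy)
    (hlegs : ∀ (G : Type) [Group G] [TopologicalSpace G] [IsTopologicalGroup G] [CompactSpace G]
      [MeasurableSpace G] [BorelSpace G], IsCompactSimpleLieGroup G →
      ∀ (r : LatticeRep G) (a : ℝ → ℝ), Continuous a → TwoPoint G r a → Skewness G r a → GapInUnits G r a →
        MomentBounds6 G r a ∧ LowerBounds G r a) :
    OSLegsAtWeakCouplingC := by
  rw [cruxC_iff]
  intro G _ _ _ _ hG
  letI : MeasurableSpace G := borel G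
  haveI : BorelSpace G := ⟨rfl⟩
  intro r a ha h1 h2 h3
  obtain ⟨h4, h5⟩ := hlegs G hG r a ha h1 h2 h3
  exact osLegsAtWeakCouplingC_retyped_pencil hDiag hNP G hG r a ha h1 h2 h3 h4 h5

/-- **The crux BY NAME from the pointwise legs, Ward form** (conditional result): E0′, NT and the rotation Ward
identity on the germ of every admissible soft-bundle limit, at every `(G, r, a)` carrying the crux hypotheses, give
`OSLegsAtWeakCouplingC` (`cruxC_iff` + `conclC_of_legs_germWard`). -/
theorem osLegsAtWeakCouplingC_of_pointwise_legs_ward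
    (hlegs : ∀ (G : Type) [Group G] [TopologicalSpace G] [IsTopologicalGroup G] [CompactSpace G]
      [MeasurableSpace G] [BorelSpace G], IsCompactSimpleLieGroup G →
      ∀ (r : LatticeRep G) (a : ℝ → ℝ), Continuous a → TwoPoint G r a → Skewness G r a → GapInUnits G r a →
        MomentBounds6 G r a ∧ LowerBounds G r a ∧
        ∀ (sch : SpeciesScheme (YMSpecies G)) (S₁ : SchwingerFamily E4)
          (Tq : (n : ℕ) → (Fin n → Fin 4 × Fin 4) → (𝓢((Fin n → E4), ℂ) →L[ℂ] ℂ)) (K : ℝ) (b₀ : ℝ) (g : ℝ → ℕ → ℕ),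
          SoftBundle G r a sch S₁ Tq K b₀ g → RPPos S₁ → OffDiagDensity S₁ →
          (∀ R : E4 ≃ₗᵢ[ℝ] E4, IsSignedPerm R → Invariant S₁ R) →
            ∃ r₀ : ℝ, 0 < r₀ ∧ ∀ (n : ℕ), 2 ≤ n → ∀ (F D : 𝓢((Fin n → E4), ℂ)), IsOffDiagonal F →
              HasCompactSupport (F : (Fin n → E4) → ℂ) →
              (∃ δ : ℝ, 0 < δ ∧ tsupport (F : (Fin n → E4) → ℂ) ⊆ Separated n δ) →
              tsupport (F : (Fin n → E4) → ℂ) ⊆ SmallDiam n r₀ →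
              (∀ x, D x = fderiv ℝ (F : (Fin n → E4) → ℂ) x
                (fun k => (x k 0) • (EuclideanSpace.single 1 1 : E4) - (x k 1) • (EuclideanSpace.single 0 1 : E4))) →
              S₁ n D = 0) :
    OSLegsAtWeakCouplingC := by
  rw [cruxC_iff]
  intro G _ _ _ _ hG
  letI : MeasurableSpace G := borel G
  haveI : BorelSpace G := ⟨rfl⟩
  intro r a ha h1 h2 h3
  obtain ⟨-, -, -, -, -, -, -, hapos, ha0, -, -⟩ := id h1
  obtain ⟨h4, h5, h6⟩ := hlegs G hG r a ha h1 h2 h3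
  exact conclC_of_legs_germWard r a hapos ha0 h3 h4 h5 h6

end Summit.QuantumFields.YangMills.Cruxes.OSLegsAtWeakCouplingC.Sketch

end
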